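import Summits.BirchSwinnertonDyer.BirchSwinnertonDyer.Theorems.ByReductionTypeAtTwoAdditiveRankZeroResidualGlue
import Summits.BirchSwinnertonDyer.BirchSwinnertonDyer.Theorems.ByReductionTypeAtTwoAdditiveKatoFineConjAAbelianTwoDivision
import HarnessLib

/-!
# Route `ByReductionTypeAtTwo` (rung K4), crux `AdditiveRankZeroAtTwo` (item stmt-BirchSwinnertonDyer-19098),
# line add_twist_overK v2: the crux BY NAME from its exact residual, `S₃`-keyed — the (A)-input restricted to the
# sub-block whose `2`-division field is NOT abelian over `ℚ` (seat `bsd-2adic-addL2x` GEN 9; `--supports … --as helper`;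
# closes nothing; D-0054: nothing filed or booked by this seat)

HONEST FRAMING (cell `bsd-2adic`, HUMAN RULING D-0036/D-0054): assembly-shaped CONDITIONAL theorem; every research-grade
input is a displayed hypothesis; closes none; BSD is not proved by any of this.

WHAT THIS FILE DOES. `additiveRankZeroAtTwo_of_residual` (`…ResidualGlue.lean`, GEN 9) glues the crux from PRINT + READING +
SIBLINGS + (I1) «(A) at `2` on the `E[2]`-IRREDUCIBLE defect-≥3 sub-block» + (I2) + (I3) + (I4). Since (A) at `2` is a theorem
from print whenever `ℚ(E[2])/ℚ` is abelian (`conjA_two_of_isAbelianGalois_divisionField_two`, `…ConjAAbelianTwoDivision.lean`,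
GEN 9), (I1) may be replaced by the sharper (I1′) «(A) at `2` on the defect-≥3 curves whose `2`-division field is NOT abelian over
`ℚ`» (the `S₃`-image sub-block, 1 163 of 1 382 census classes) at the cost of one more PRINT binder (`hLim2`, `hFW`). This file
records that variant, `additiveRankZeroAtTwo_of_residual_S3`, so that the planner's RC-210 (3) item can be filed in either scope
with a kernel-checked glue already in the tree.

References: as `…ResidualGlue.lean`; [Lim2017FineSelmer] §3 Thm. 3.5; [FerreroWashington1979]; [CoatesSujatha2005] statement (A).
Memo: `run/shared/lean/pub/bsd-2adic/addL2x/VERDICT-19098-addL2x-GEN9.md`.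
-/

set_option autoImplicit false
-- sibling precedent (`ByReductionTypeAtTwoAdditiveRankZeroResidualGlue.lean`): the directory name repeats the summit name
set_option linter.dupNamespace false

noncomputable section

open scoped Classical

namespace Summit.BirchSwinnertonDyer.BirchSwinnertonDyer.Theorems.AddKatoTwo

open WeierstrassCurve Literature.NumberTheory.EllipticCurves
  Literature.NumberTheory.EllipticCurves.Rank1Residual
  Literature.NumberTheory.EllipticCurves.Rank1Residual.Typed
  Literature.NumberTheory.IwasawaTheory
  Summit.BirchSwinnertonDyer.Rank1Residual.AdditivePotMult
  Summit.BirchSwinnertonDyer.Rank1Residual.X5.AddTwoL2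
  Summit.BirchSwinnertonDyer.BirchSwinnertonDyer.Theses.ByReductionTypeAtTwo

/-- **The crux `AdditiveRankZeroAtTwo` BY NAME from its exact residual, `S₃`-keyed**: PRINT {`hGZK`, `hmod`, `hMilneC`, `hHL`,
`hMM`, `hLim2`, `hFW`} + READING {`hSharp`} + SIBLINGS {`hOrd`, `hMult`, `hSS`} + (I1′) `hAS3` (Coates–Sujatha (A) at `2` on the
non-CM `r_an = 0` defect-≥3 curves whose `2`-division field is NOT abelian over `ℚ`) + (I2) `hUred` (upper half on the
`E[2]`-reducible sub-block) + (I3) `hKC` (`stub_addDefectOverKC`) + (I4) `hQK` (`stub_addQuadraticOverK`). (I1′) is spread to the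
whole block by `addBlock_conjA_two_of_S3` (abelian `ℚ(E[2])` ⇒ (A) from print) and fed to `additiveRankZeroAtTwo_of_residual`.
Conditional; nothing asserted. [cite: Kato2004Asterisque, Thm. 12.5 (1)(3) (pp. 221–222)] [cite: CoatesSujatha2005, statement (A)]
[cite: Lim2017FineSelmer, §3 Thm. 3.5] [cite: FerreroWashington1979, Theorem] -/
theorem additiveRankZeroAtTwo_of_residual_S3
    (hGZK : rank_eq_analyticRank_of_analyticRank_le_one) (hmod : hasEntireLFunction_rat)
    (hMilneC : Milne1972.bsdQuotient_baseChange_quadratic_anyModel)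
    (hHL : HoffsteinLuo1997_exists_twist_L_one_ne_zero)
    (hMM : murtyMurty_exists_twist_ne_zero_prescribedAtTwo)
    (hLim2 : Lim2017.thm35_at_two_fineSelmerDual_moduleFinite_of_classicalMuVanishes_of_le_divisionField_four)
    (hFW : ferreroWashington1979_classicalMuVanishes)
    (hSharp : Kato2004.rankZero_padicValNat_sha_add_padicValNat_tamagawa_le_at_two_of_irreducible_of_fineSelmerDual_fg)
    (hOrd : GoodOrdinaryRankZeroAtTwo) (hMult : MultiplicativeRankZeroAtTwo) (hSS : SupersingularRankZeroAtTwo)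
    (hAS3 : ∀ (W : WeierstrassCurve ℚ) [W.IsElliptic] [W.IsGloballyMinimal], ¬ W.HasCM → W.analyticRank = 0 →
      DefectAtLeastThree W → ¬ IsAbelianGalois ℚ (W.divisionField 2) →
      ∀ (κ : ZpExtension ℚ 2), κ.IsCyclotomic →
        ∃ (γ : Field.absoluteGaloisGroup ℚ) (D : W.FineSelmerDualData κ γ),
          Module.Finite ℤ_[2] (RestrictScalars ℤ_[2] (IwasawaAlgebra 2) D.X))
    (hUred : ∀ (W : WeierstrassCurve ℚ) [W.IsElliptic] [W.IsGloballyMinimal], ¬ W.HasCM → W.analyticRank = 0 →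
      DefectAtLeastThree W → ¬ W.HasIrreducibleModPGaloisRep 2 → MissingUpperBoundAt W 2)
    (hKC : ∀ (W : WeierstrassCurve ℚ) [W.IsElliptic] [W.IsGloballyMinimal], ¬ W.HasCM → W.analyticRank = 0 →
      DefectAtLeastThree W → ∀ (K : Type) [Field K] [NumberField K], Module.finrank ℚ K = 2 → TwoInert K →
        (W.quadraticTwist (NumberField.discr K : ℚ)).entireLFunction 1 ≠ 0 →
          MissingPPartOverCAt (W.baseChange K) 2)
    (hQK : ∀ (W : WeierstrassCurve ℚ) [W.IsElliptic] [W.IsGloballyMinimal], ¬ W.HasCM → W.analyticRank = 0 →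
      Addv W 2 → ∀ (K : Type) [Field K] [NumberField K], Module.finrank ℚ K = 2 →
        SemistableTwistAtTwo W K → (W.quadraticTwist (NumberField.discr K : ℚ)).entireLFunction 1 ≠ 0 →
          MissingPPartOverCAt (W.baseChange K) 2) :
    Summit.BirchSwinnertonDyer.BirchSwinnertonDyer.Theses.ByReductionTypeAtTwo.AdditiveRankZeroAtTwo :=
  additiveRankZeroAtTwo_of_residual hGZK hmod hMilneC hHL hMM hSharp hOrd hMult hSS
    (fun W _ _ hcm hr hdef _ => addBlock_conjA_two_of_S3 hLim2 hFW hAS3 W hcm hr hdef) hUred hKC hQK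

end Summit.BirchSwinnertonDyer.BirchSwinnertonDyer.Theorems.AddKatoTwo

end
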